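import Summits.ResolutionOfSingularities.ResolutionOfSingularities.Theorems.PurelyInseparableDim4ResConeDiagonalLinearPart
import HarnessLib
import HarnessLib.Audit.Tags

/-!
# Purely inseparable four-folds — TRIANGULAR TRANSFER OF COEFFICIENTS THROUGH A UNIT-CLASS SUBSTITUTION
# (cell `res-dim4-pi`, K2(p) lane, slice B, brick K24a-R1 «read through a unit-class frame», FILE R1-read)

[OURS · counted 0 · cell `res-dim4-pi` · K2(p) lane (holder res-dim4-p-12 g3) · seat res-dim4-p-7 g4 · signatures (R1a) of
res-dim4-p-1 g4 (bus 2026-08-29T04:06:25Z), generalised.]  Nothing here proves K2(p)/K2(5), `NoIsolatedTrap p p`, or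
resolution of singularities in dimension ≥ 4 / characteristic `p`.  AI kernel work, weaker than expert review.

Setting (as in SN3/SN3b/SN4a).  A substitution `θ` of UNIT CLASS along a letter bijection `π` with free letter `f`:
`θ(x_{π i}) = x_i · e_i` (`i ≠ f`), `θ(x_{π f}) = x_f · e_f + G`, the `e_i` ARBITRARY polynomials (units when `e_i(0) ≠ 0`),
`G` with no `x_f`-monomial and whose `x_f`-FREE monomials have degree `≥ s` (`1 ≤ s`).  Write `n♯ := n.mapDomain π⁻¹`, so
`(n♯) i = n (π i)` and `θ(x^n) = x^{n♯} · (units) + …`.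

* §1 exponent transport `n ↦ n♯` (order, singles, erase; apply/degree are res-dim4-p-1 g4's `ResCone.mapDomain_symm_apply` /
  `ResCone.degree_mapDomain_perm`).
* §2 the SUPPORT FILTER: every monomial `t` of `θ(c · x^m)` satisfies, for some splitting `i + j = m (π f)`,
  `(m.erase (π f))♯ + i·e_f ≤ t` and `|m.erase (π f)| + i + j·s ≤ |t|` (the `j` factors `G` taken from `(x_f e_f + G)^{m(πf)}`
  cost degree `s` each); and the TOP COEFFICIENT `coeff_{m♯} θ(c·x^m) = c · ∏ e_i(0)^{m (π i)}` (`support_aeval_monomial`,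
  `coeff_aeval_monomial_self`).
* §3 `θ(c·x^m)` factored (`aeval_monomial_unitClass`); §4 **`coeff_aeval_unitClass`** (TRIANGULAR TRANSFER): if
  `coeff_{m₀ + j·e_{πf}} P = 0` for every `(m₀, j)` with `m₀ ≤ n`, `|m₀| + j·s ≤ |n|`, `m₀ + j·e_{πf} ≠ n`, then
  `coeff_{n♯} θ(P) = (∏ e_i(0)^{n(π i)}) · coeff_n P`; the DIAGONAL case **`coeff_aeval_diag_of_lower_eq_zero`** (`G = 0`:
  only `n' ≤ n`, `n' ≠ n` — res-dim4-p-1 g4's (R1a) verbatim).  The dressed forms through a re-presentation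
  `Q = clean_q(V · θ P) + D` are in `…UnitClassTransferRel`.

Characteristic-free (`K` any field); no frames, no `p`.  How the consumer gets `s`: both ends STRAIGHT ⇒ `s ≥ 2`; both ends
Tschirnhaus at degree 4 ⇒ the `x_f`-free quadratic part of `G` vanishes (`s ≥ 3`) — separate file.  CAVEAT recorded for
the lane: `G ∈ 𝔪₀^{N+1}` is NOT forced by «straight + Tschirnhaus to order N at both ends» when the units carry `x_f`
(example `G_A = Y³ + X⁴`, `θ(X) = x(1 + c y²)`, `θ(Y) = y − (4c/3)x⁴`: both ends straight and Tschirnhaus to every order).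
[cite: Hauser2010, §§F–G (chart expressions; cleaning)] [folklore]
bears_on: LADDER-RESOLUTION:D157-DOOR2 (res-dim4-pi · K2(p) · slice B · K24a-R1 read).  Supports
stmt-ResolutionOfSingularities-16155 (helper).
-/

set_option linter.dupNamespace false -- mandated namespace of this single-conjunct summit

noncomputable section

namespace Summit.ResolutionOfSingularities.ResolutionOfSingularities.Theorems.PIDim4

namespace SwapNorm

open MvPolynomial Finset
open Literature.AlgebraicGeometry.Resolution
open Literature.AlgebraicGeometry.Resolution.Hauser2010

variable {K : Type} [Field K]

/-! ## §1 Exponent transport along the letter bijection -/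

/-! `(n♯) i = n (π i)` and `|n♯| = |n|` are res-dim4-p-1 g4's `ResCone.mapDomain_symm_apply` /
`ResCone.degree_mapDomain_perm` (`…ResConeDiagonalLinearPart`), imported. -/

/-- `a♯ ≤ b♯ ↔ a ≤ b`. [folklore] -/
theorem mapDomain_perm_le_iff (π : Equiv.Perm (Fin 4)) (a b : Fin 4 →₀ ℕ) :
    Finsupp.mapDomain π.symm a ≤ Finsupp.mapDomain π.symm b ↔ a ≤ b := by
  simp only [Finsupp.le_def, ResCone.mapDomain_symm_apply]
  refine ⟨fun h i => ?_, fun h i => h (π i)⟩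
  have := h (π.symm i)
  rwa [Equiv.apply_symm_apply] at this

/-- `(single (π f) j)♯ = single f j`. [folklore] -/
theorem mapDomain_perm_single (π : Equiv.Perm (Fin 4)) (f : Fin 4) (j : ℕ) :
    Finsupp.mapDomain π.symm (Finsupp.single (π f) j) = Finsupp.single f j := by
  rw [Finsupp.mapDomain_single, Equiv.symm_apply_apply]

/-- `(m.erase (π f))♯ + (m (π f))·e_f = m♯`. [folklore] -/
theorem mapDomain_perm_erase_add_single (π : Equiv.Perm (Fin 4)) (f : Fin 4) (m : Fin 4 →₀ ℕ) :
    Finsupp.mapDomain π.symm (m.erase (π f)) + Finsupp.single f (m (π f)) = Finsupp.mapDomain π.symm m := by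
  rw [← mapDomain_perm_single π f, ← Finsupp.mapDomain_add, Finsupp.erase_add_single]

/-- An exponent dominating `a`, agreeing with `a` off `f`, of total degree `|a| + k` is `a + k·e_f`. [folklore] -/
theorem eq_add_single_of_degree {a t : Fin 4 →₀ ℕ} {f : Fin 4} {k : ℕ}
    (hl : ∀ l, l ≠ f → t l = a l) (hdeg : t.degree = a.degree + k) : t = a + Finsupp.single f k := by
  have ht : t f + ∑ l ∈ univ.erase f, t l = t.degree := by
    rw [Finsupp.degree_eq_sum]; exact add_sum_erase univ (fun l => t l) (mem_univ f)
  have ha : a f + ∑ l ∈ univ.erase f, a l = a.degree := by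
    rw [Finsupp.degree_eq_sum]; exact add_sum_erase univ (fun l => a l) (mem_univ f)
  have hS : ∑ l ∈ univ.erase f, t l = ∑ l ∈ univ.erase f, a l :=
    sum_congr rfl fun l hl' => hl l (ne_of_mem_erase hl')
  have hf : t f = a f + k := by omega
  ext l
  by_cases hlf : l = f
  · subst hlf; rw [Finsupp.add_apply, Finsupp.single_eq_same, hf]
  · rw [Finsupp.add_apply, Finsupp.single_eq_of_ne hlf, add_zero, hl l hlf]

/-! ## §2 The support filter and the top coefficient

The filter `FIL(a, k)` of a polynomial `Q` (letters `f`, `s` fixed): every `t ∈ supp Q` admits `i + j = k` with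
`a + i·e_f ≤ t` and `|a| + i + j·s ≤ |t|`; its top exponent is `a + k·e_f`.  It is multiplicative (`fil_mul`), and so is the
top coefficient (`coeff_top_mul`). -/

/-- Every polynomial lies in `FIL(0, 0)`. [folklore] -/
theorem fil_zero_zero (f : Fin 4) (s : ℕ) (Q : MvPolynomial (Fin 4) K) :
    ∀ t ∈ Q.support, ∃ i j : ℕ, i + j = 0 ∧ (0 : Fin 4 →₀ ℕ) + Finsupp.single f i ≤ t ∧
      (0 : Fin 4 →₀ ℕ).degree + i + j * s ≤ t.degree :=
  fun t _ => ⟨0, 0, rfl, by simp, by simp⟩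

/-- A monomial `x^a` lies in `FIL(a, 0)`. [folklore] -/
theorem fil_monomial (f : Fin 4) (s : ℕ) (a : Fin 4 →₀ ℕ) (c : K) :
    ∀ t ∈ (monomial a c).support, ∃ i j : ℕ, i + j = 0 ∧ a + Finsupp.single f i ≤ t ∧
      a.degree + i + j * s ≤ t.degree := by
  intro t ht
  have hta : t = a := Finset.mem_singleton.mp (support_monomial_subset ht)
  subst hta
  exact ⟨0, 0, rfl, by simp, by simp⟩

/-- `x_f · e + G` lies in `FIL(0, 1)` when the `x_f`-free monomials of `G` have degree `≥ s`. [folklore] -/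
theorem fil_X_mul_add (f : Fin 4) {s : ℕ} (ef G : MvPolynomial (Fin 4) K)
    (hG : ∀ d ∈ G.support, d f = 0 → s ≤ d.degree) :
    ∀ t ∈ (X f * ef + G).support, ∃ i j : ℕ, i + j = 1 ∧ (0 : Fin 4 →₀ ℕ) + Finsupp.single f i ≤ t ∧
      (0 : Fin 4 →₀ ℕ).degree + i + j * s ≤ t.degree := by
  classical
  intro t ht
  rcases Finset.mem_union.mp (support_add ht) with h | h
  · have h1 : Finsupp.single f 1 ≤ t := by
      have hc : coeff t (X f * ef) ≠ 0 := mem_support_iff.mp h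
      rw [coeff_X_mul'] at hc
      split_ifs at hc with hf
      · exact Finsupp.single_le_iff.mpr (Nat.one_le_iff_ne_zero.mpr (Finsupp.mem_support_iff.mp hf))
      · exact absurd rfl hc
    refine ⟨1, 0, rfl, by simpa using h1, ?_⟩
    have := Finsupp.le_degree f t
    have h1' : 1 ≤ t f := Finsupp.single_le_iff.mp h1
    simp only [map_zero, zero_add, zero_mul, add_zero]
    omega
  · by_cases htf : t f = 0
    · exact ⟨0, 1, rfl, by simp, by simpa using hG t h htf⟩
    · refine ⟨1, 0, rfl, ?_, ?_⟩
      · simpa [Finsupp.single_le_iff] using Nat.one_le_iff_ne_zero.mpr htf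
      · have := Finsupp.le_degree f t
        simp only [map_zero, zero_add, zero_mul, add_zero]
        omega

/-- **The filter is multiplicative.** [folklore] -/
theorem fil_mul {f : Fin 4} {s : ℕ} {a a' : Fin 4 →₀ ℕ} {k k' : ℕ} {Q Q' : MvPolynomial (Fin 4) K}
    (hQ : ∀ t ∈ Q.support, ∃ i j : ℕ, i + j = k ∧ a + Finsupp.single f i ≤ t ∧ a.degree + i + j * s ≤ t.degree)
    (hQ' : ∀ t ∈ Q'.support, ∃ i j : ℕ, i + j = k' ∧ a' + Finsupp.single f i ≤ t ∧
      a'.degree + i + j * s ≤ t.degree) :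
    ∀ t ∈ (Q * Q').support, ∃ i j : ℕ, i + j = k + k' ∧ (a + a') + Finsupp.single f i ≤ t ∧
      (a + a').degree + i + j * s ≤ t.degree := by
  intro t ht
  obtain ⟨t₁, ht₁, t₂, ht₂, rfl⟩ := Finset.mem_add.mp (support_mul Q Q' ht)
  obtain ⟨i, j, hij, hle, hdeg⟩ := hQ t₁ ht₁
  obtain ⟨i', j', hij', hle', hdeg'⟩ := hQ' t₂ ht₂
  refine ⟨i + i', j + j', by omega, ?_, ?_⟩
  · rw [Finsupp.single_add, add_add_add_comm]
    exact add_le_add hle hle'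
  · rw [map_add, map_add, add_mul]
    omega

/-- **The top coefficient is multiplicative**: at `a + a' + (k + k')·e_f` the product `Q · Q'` has coefficient
`coeff_{a + k·e_f} Q · coeff_{a' + k'·e_f} Q'` (all other splittings miss the supports). [folklore] -/
theorem coeff_top_mul {f : Fin 4} {s : ℕ} (hs : 1 ≤ s) {a a' : Fin 4 →₀ ℕ} {k k' : ℕ}
    {Q Q' : MvPolynomial (Fin 4) K}
    (hQ : ∀ t ∈ Q.support, ∃ i j : ℕ, i + j = k ∧ a + Finsupp.single f i ≤ t ∧ a.degree + i + j * s ≤ t.degree)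
    (hQ' : ∀ t ∈ Q'.support, ∃ i j : ℕ, i + j = k' ∧ a' + Finsupp.single f i ≤ t ∧
      a'.degree + i + j * s ≤ t.degree) :
    coeff (a + a' + Finsupp.single f (k + k')) (Q * Q') =
      coeff (a + Finsupp.single f k) Q * coeff (a' + Finsupp.single f k') Q' := by
  classical
  rw [coeff_mul]
  apply Finset.sum_eq_single (a + Finsupp.single f k, a' + Finsupp.single f k')
  · rintro ⟨t₁, t₂⟩ hanti hne
    by_contra h
    obtain ⟨i, j, hij, hle, hdeg⟩ := hQ t₁ (mem_support_iff.mpr (left_ne_zero_of_mul h))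
    obtain ⟨i', j', hij', hle', hdeg'⟩ := hQ' t₂ (mem_support_iff.mpr (right_ne_zero_of_mul h))
    have hsum : t₁ + t₂ = a + a' + Finsupp.single f (k + k') := Finset.HasAntidiagonal.mem_antidiagonal.mp hanti
    have hjs : j ≤ j * s := Nat.le_mul_of_pos_right j hs
    have hjs' : j' ≤ j' * s := Nat.le_mul_of_pos_right j' hs
    have hdsum : t₁.degree + t₂.degree = a.degree + a'.degree + (k + k') := by
      rw [← map_add, hsum, map_add, map_add, Finsupp.degree_single]
    have hd₁ : t₁.degree = a.degree + k := by omega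
    have hd₂ : t₂.degree = a'.degree + k' := by omega
    have hpt : ∀ l, l ≠ f → t₁ l = a l ∧ t₂ l = a' l := by
      intro l hlf
      have h1 : a l ≤ t₁ l := by
        have := (Finsupp.le_def.mp hle) l
        rw [Finsupp.add_apply] at this; omega
      have h2 : a' l ≤ t₂ l := by
        have := (Finsupp.le_def.mp hle') l
        rw [Finsupp.add_apply] at this; omega
      have h3 := DFunLike.congr_fun hsum l
      simp only [Finsupp.add_apply, Finsupp.single_eq_of_ne hlf, add_zero] at h3
      omega
    apply hne
    rw [eq_add_single_of_degree (fun l hl => (hpt l hl).1) hd₁,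
      eq_add_single_of_degree (fun l hl => (hpt l hl).2) hd₂]
  · intro h
    exact absurd (Finset.HasAntidiagonal.mem_antidiagonal.mpr (by rw [Finsupp.single_add, add_add_add_comm])) h

/-- Powers of an element of `FIL(0, 1)`: `Q^k ∈ FIL(0, k)` with top coefficient `(coeff_{e_f} Q)^k`. [folklore] -/
theorem fil_pow {f : Fin 4} {s : ℕ} (hs : 1 ≤ s) {Q : MvPolynomial (Fin 4) K}
    (hQ : ∀ t ∈ Q.support, ∃ i j : ℕ, i + j = 1 ∧ (0 : Fin 4 →₀ ℕ) + Finsupp.single f i ≤ t ∧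
      (0 : Fin 4 →₀ ℕ).degree + i + j * s ≤ t.degree) (k : ℕ) :
    (∀ t ∈ (Q ^ k).support, ∃ i j : ℕ, i + j = k ∧ (0 : Fin 4 →₀ ℕ) + Finsupp.single f i ≤ t ∧
      (0 : Fin 4 →₀ ℕ).degree + i + j * s ≤ t.degree) ∧
    coeff (Finsupp.single f k) (Q ^ k) = coeff (Finsupp.single f 1) Q ^ k := by
  induction k with
  | zero =>
    refine ⟨by rw [pow_zero]; exact fil_zero_zero f s 1, ?_⟩
    rw [pow_zero, pow_zero, Finsupp.single_zero]
    exact coeff_zero_one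
  | succ k ih =>
    obtain ⟨hk, hck⟩ := ih
    refine ⟨fun t ht => ?_, ?_⟩
    · obtain ⟨i, j, hij, hle, hdeg⟩ := fil_mul hk hQ t (by rwa [pow_succ] at ht)
      exact ⟨i, j, hij, by simpa using hle, by simpa using hdeg⟩
    · have h := coeff_top_mul hs hk hQ
      simp only [zero_add, add_zero] at h
      rw [pow_succ, h, hck, pow_succ]

/-! ## §3 A unit-class substitution on a monomial -/

section UnitClass

variable {π : Equiv.Perm (Fin 4)} {f : Fin 4} {θ e : Fin 4 → MvPolynomial (Fin 4) K} {G : MvPolynomial (Fin 4) K}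
  {s : ℕ}

/-- The monomial of `θ(x^m)` off the free letter: `∏_{i ≠ f} x_i^{m (π i)} = x^{(m.erase (π f))♯}`. [folklore] -/
theorem prod_erase_X_pow_eq_monomial (π : Equiv.Perm (Fin 4)) (f : Fin 4) (m : Fin 4 →₀ ℕ) :
    ∏ i ∈ univ.erase f, (X i : MvPolynomial (Fin 4) K) ^ m (π i) =
      monomial (Finsupp.mapDomain π.symm (m.erase (π f))) 1 := by
  rw [monomial_eq, C_1, one_mul, Finsupp.prod_fintype _ _ (fun i => pow_zero _),
    ← mul_prod_erase univ _ (mem_univ f)]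
  rw [ResCone.mapDomain_symm_apply, Finsupp.erase_same, pow_zero, one_mul]
  refine prod_congr rfl fun i hi => ?_
  rw [ResCone.mapDomain_symm_apply, Finsupp.erase_ne (fun h => ne_of_mem_erase hi (π.injective h))]

/-- **`θ(c·x^m)` factored**: `C c · (x^{(m.erase (πf))♯} · ∏_{i≠f} e_i^{m(πi)}) · (x_f e_f + G)^{m(πf)}`. [folklore] -/
theorem aeval_monomial_unitClass (hθi : ∀ i, i ≠ f → θ (π i) = X i * e i) (hθf : θ (π f) = X f * e f + G)
    (m : Fin 4 →₀ ℕ) (c : K) :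
    aeval θ (monomial m c) =
      C c * ((monomial (Finsupp.mapDomain π.symm (m.erase (π f))) 1 * ∏ i ∈ univ.erase f, e i ^ m (π i)) *
        (X f * e f + G) ^ m (π f)) := by
  rw [aeval_monomial, algebraMap_eq, Finsupp.prod_fintype _ _ (fun i => pow_zero _),
    ← Equiv.prod_comp π (fun l => θ l ^ m l)]
  rw [← mul_prod_erase univ (fun i => θ (π i) ^ m (π i)) (mem_univ f), hθf,
    ← prod_erase_X_pow_eq_monomial π f m, ← prod_mul_distrib]
  congr 1
  rw [mul_comm]
  congr 1
  exact prod_congr rfl fun i hi => by rw [hθi i (ne_of_mem_erase hi), mul_pow]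

/-- **SUPPORT of `θ(c·x^m)`**: every monomial `t` admits a splitting `i + j = m (π f)` with
`(m.erase (π f))♯ + i·e_f ≤ t` and `|m.erase (π f)| + i + j·s ≤ |t|`. [folklore] -/
theorem support_aeval_monomial (hθi : ∀ i, i ≠ f → θ (π i) = X i * e i) (hθf : θ (π f) = X f * e f + G)
    (hG : ∀ d ∈ G.support, d f = 0 → s ≤ d.degree) (hs : 1 ≤ s) (m : Fin 4 →₀ ℕ) (c : K) :
    ∀ t ∈ (aeval θ (monomial m c)).support, ∃ i j : ℕ, i + j = m (π f) ∧
      Finsupp.mapDomain π.symm (m.erase (π f)) + Finsupp.single f i ≤ t ∧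
      (m.erase (π f)).degree + i + j * s ≤ t.degree := by
  intro t ht
  rw [aeval_monomial_unitClass hθi hθf] at ht
  have h1 := fil_mul (fil_monomial f s (Finsupp.mapDomain π.symm (m.erase (π f))) (1 : K))
    (fil_zero_zero f s (∏ i ∈ univ.erase f, e i ^ m (π i)))
  have h2 := fil_mul h1 (fil_pow hs (fil_X_mul_add f (e f) G hG) (m (π f))).1
  have h3 := fil_mul (fil_zero_zero f s (C c : MvPolynomial (Fin 4) K)) h2
  obtain ⟨i, j, hij, hle, hdeg⟩ := h3 t ht
  simp only [zero_add, add_zero] at hij hle hdeg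
  rw [ResCone.degree_mapDomain_perm] at hdeg
  exact ⟨i, j, hij, hle, hdeg⟩

/-- **TOP COEFFICIENT of `θ(c·x^m)`**: `coeff_{m♯} θ(c·x^m) = c · ∏ e_i(0)^{m(π i)}` (no `x_f`-term in `G`). [folklore] -/
theorem coeff_aeval_monomial_self (hθi : ∀ i, i ≠ f → θ (π i) = X i * e i) (hθf : θ (π f) = X f * e f + G)
    (hG1 : coeff (Finsupp.single f 1) G = 0) (hG : ∀ d ∈ G.support, d f = 0 → s ≤ d.degree) (hs : 1 ≤ s)
    (m : Fin 4 →₀ ℕ) (c : K) :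
    coeff (Finsupp.mapDomain π.symm m) (aeval θ (monomial m c)) = c * ∏ i, constantCoeff (e i) ^ m (π i) := by
  classical
  rw [aeval_monomial_unitClass hθi hθf, coeff_C_mul]
  congr 1
  have h1 := fil_mul (fil_monomial f s (Finsupp.mapDomain π.symm (m.erase (π f))) (1 : K))
    (fil_zero_zero f s (∏ i ∈ univ.erase f, e i ^ m (π i)))
  have hB := fil_pow hs (fil_X_mul_add f (e f) G hG) (m (π f))
  have htop := coeff_top_mul hs h1 hB.1
  have htop1 := coeff_top_mul hs (fil_monomial f s (Finsupp.mapDomain π.symm (m.erase (π f))) (1 : K))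
    (fil_zero_zero f s (∏ i ∈ univ.erase f, e i ^ m (π i)))
  simp only [add_zero, zero_add, Finsupp.single_zero] at htop htop1
  rw [mapDomain_perm_erase_add_single] at htop
  rw [htop, htop1, hB.2, coeff_monomial, if_pos rfl, one_mul, coeff_add, coeff_X_mul', if_pos (by simp), hG1,
    add_zero, tsub_self, ← constantCoeff_eq, map_prod]
  simp_rw [map_pow]
  rw [← mul_prod_erase univ (fun i => constantCoeff (e i) ^ m (π i)) (mem_univ f), mul_comm]

/-! ## §4 THE TRIANGULAR TRANSFER -/

/-- **TRIANGULAR TRANSFER THROUGH A UNIT-CLASS SUBSTITUTION.**  `θ(x_{πi}) = x_i e_i` (`i ≠ f`), `θ(x_{πf}) = x_f e_f + G`,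
no `x_f`-term in `G`, the `x_f`-free monomials of `G` of degree `≥ s ≥ 1`.  If the coefficients of `P` vanish at every
`m₀ + j·e_{πf} ≠ n` with `m₀ ≤ n` and `|m₀| + j·s ≤ |n|` (the exponents whose image can shadow `n♯`), then
`coeff_{n♯} θ(P) = (∏ e_i(0)^{n(π i)}) · coeff_n P`. [folklore] -/
theorem coeff_aeval_unitClass (hθi : ∀ i, i ≠ f → θ (π i) = X i * e i) (hθf : θ (π f) = X f * e f + G)
    (hG1 : coeff (Finsupp.single f 1) G = 0) (hG : ∀ d ∈ G.support, d f = 0 → s ≤ d.degree) (hs : 1 ≤ s)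
    (P : MvPolynomial (Fin 4) K) {n : Fin 4 →₀ ℕ}
    (hlow : ∀ (m₀ : Fin 4 →₀ ℕ) (j : ℕ), m₀ ≤ n → m₀.degree + j * s ≤ n.degree →
      m₀ + Finsupp.single (π f) j ≠ n → coeff (m₀ + Finsupp.single (π f) j) P = 0) :
    coeff (Finsupp.mapDomain π.symm n) (aeval θ P) = (∏ i, constantCoeff (e i) ^ n (π i)) * coeff n P := by
  classical
  conv_lhs => rw [as_sum P, map_sum, coeff_sum]
  rw [Finset.sum_eq_single n]
  · rw [coeff_aeval_monomial_self hθi hθf hG1 hG hs, mul_comm]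
  · intro m hm hmn
    by_contra hne
    obtain ⟨i, j, hij, hle, hdeg⟩ := support_aeval_monomial hθi hθf hG hs m (coeff m P) _ (mem_support_iff.mpr hne)
    have hle' : m.erase (π f) + Finsupp.single (π f) i ≤ n := by
      rw [← mapDomain_perm_le_iff π, Finsupp.mapDomain_add, mapDomain_perm_single]; exact hle
    have hdeg' : (m.erase (π f) + Finsupp.single (π f) i).degree + j * s ≤ n.degree := by
      rw [map_add, Finsupp.degree_single, ← ResCone.degree_mapDomain_perm π.symm n]; exact hdeg
    have hm' : m.erase (π f) + Finsupp.single (π f) i + Finsupp.single (π f) j = m := by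
      rw [add_assoc, ← Finsupp.single_add, hij, Finsupp.erase_add_single]
    have h0 := hlow _ j hle' hdeg' (by rw [hm']; exact hmn)
    rw [hm'] at h0
    exact (mem_support_iff.mp hm) h0
  · intro hn
    rw [notMem_support_iff.mp hn, monomial_zero, map_zero, coeff_zero]

/-- **(R1a) TRIANGULAR TRANSFER FOR A DIAGONAL UNIT SUBSTITUTION** (res-dim4-p-1 g4's signature): `θ(x_{πi}) = x_i e_i`
for all `i`; if `coeff_{n'} P = 0` for every `n' ≤ n`, `n' ≠ n`, then `coeff_{n♯} θ(P) = (∏ e_i(0)^{n(πi)}) · coeff_n P`.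
[folklore] -/
theorem coeff_aeval_diag_of_lower_eq_zero (hθ : ∀ i, θ (π i) = X i * e i) (P : MvPolynomial (Fin 4) K)
    {n : Fin 4 →₀ ℕ} (hlow : ∀ n' ≤ n, n' ≠ n → coeff n' P = 0) :
    coeff (Finsupp.mapDomain π.symm n) (aeval θ P) = (∏ i, constantCoeff (e i) ^ n (π i)) * coeff n P := by
  have hθf : θ (π 0) = X 0 * e 0 + 0 := by rw [hθ 0, add_zero]
  refine coeff_aeval_unitClass (f := 0) (s := n.degree + 1) (fun i _ => hθ i) hθf (coeff_zero _)
    (fun d hd => absurd hd (by simp)) (Nat.succ_le_succ (Nat.zero_le _)) P fun m₀ j hle hdeg hne => ?_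
  rcases Nat.eq_zero_or_pos j with rfl | hj
  · rw [Finsupp.single_zero, add_zero] at hne ⊢
    exact hlow m₀ hle hne
  · exfalso
    have : n.degree + 1 ≤ j * (n.degree + 1) := Nat.le_mul_of_pos_left _ hj
    omega

end UnitClass

end SwapNorm

end Summit.ResolutionOfSingularities.ResolutionOfSingularities.Theorems.PIDim4

end
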